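import Summits.BirchSwinnertonDyer.BirchSwinnertonDyer.Theorems.Rank2ObservatoryRank3WitnessT2
import HarnessLib

/-!
# BirchSwinnertonDyer — rank ≥ 2 observatory: rank-3 kernel certificate, coset tests modulo the RATIONAL 2-torsion only

HONEST FRAMING: per-curve certified theorems and census instruments; no claim on BSD in rank ≥ 2.

The rank-3 kernel certificates at torsion exponent `u = 1` (`Rank2ObservatoryRank3Witness[T|T2]`)
test a combination `R = ε·P` by `R̃ ∉ 2Ẽ(𝔽_q) + Ẽ(𝔽_q)[2]` (`xCosetFree`). When `E(ℚ)[2] ≅ ℤ/2` but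
`Ẽ(𝔽_q)[2]` is bigger, that test is stronger than the independence criterion needs, and for 17 rank-3
census rows some combination is inside `2Ẽ + Ẽ[2]` at every good prime `q ≤ 199` although it is not in
`2E(ℚ) + E(ℚ)[2]`. This file tests modulo the RATIONAL `2`-torsion only: with `E(ℚ)[2] = {O, T}`
certified as in `Rank2ObservatoryRank3WitnessT2` (`twoTorsionOnlyB` at a good odd prime `ℓ₁`),
`R ∉ 2E(ℚ) + E(ℚ)[2]` follows from ONE good prime `q` with `R̃ ∉ 2Ẽ(𝔽_q)` and `R̃ + T̃ ∉ 2Ẽ(𝔽_q)`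
(`tCosetFree`: a chord certificate for `R̃ + T̃` and two `xDoubleFree` tests). Results:
`not_mem_twoCoset_one_of_twoTorsion_subset` (abstract), `twoTorsion_eq_zero_or_eq`,
`not_mem_twoCoset_one_of_tCosetFree`, and the certificate `three_le_mordellWeilRank_of_kernelCertT3`.
Sorry-free. References: Silverman AEC (2009) III.2.3, VII.3.1(b), VIII.6.7; Cremona (1997) §3.5.
-/

-- single-conjunct summit: `Summit.BirchSwinnertonDyer.BirchSwinnertonDyer.…` repeats the name by design
set_option linter.dupNamespace false

namespace Summit.BirchSwinnertonDyer.BirchSwinnertonDyer.Rank2Observatory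

open WeierstrassCurve Literature.NumberTheory.EllipticCurves

section Abstract

variable {A : Type*} [AddCommGroup A]

/-- If the `2`-torsion of `A` is contained in `{0, T}` and neither `x` nor `x + T` lies in `2A`, then
`x ∉ 2A + A[2]`. [folklore] -/
theorem not_mem_twoCoset_one_of_twoTorsion_subset {T x : A}
    (h2 : ∀ τ : A, (2 : ℤ) • τ = 0 → τ = 0 ∨ τ = T)
    (hx : x ∉ twoCoset A 0) (hxT : x + T ∉ twoCoset A 0) : x ∉ twoCoset A 1 := by
  rintro ⟨b, c, hc, rfl⟩
  rw [pow_one] at hc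
  rcases h2 c hc with rfl | rfl
  · exact hx ⟨b, 0, by rw [smul_zero], rfl⟩
  · apply hxT
    refine ⟨b + c, 0, by rw [smul_zero], ?_⟩
    rw [add_zero, smul_add]
    abel

end Abstract

section Rational

variable (V : WeierstrassCurve ℤ)

open scoped Classical in
/-- An integral point `(x_T, y_T)` with `2y_T + a₁x_T + a₃ = 0` is `2`-torsion in `E(ℚ)`.
[cite: SilvermanAEC2009, III.2.3] -/
theorem two_nsmul_some_eq_zero (hΔ : V.Δ ≠ 0) {xT yT : ℤ}
    (hT : yT ^ 2 + V.a₁ * xT * yT + V.a₃ * yT = xT ^ 3 + V.a₂ * xT ^ 2 + V.a₄ * xT + V.a₆)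
    (hT2 : 2 * yT + V.a₁ * xT + V.a₃ = 0) :
    haveI := isElliptic_rat V hΔ
    2 • (Affine.Point.some (xT : ℚ) (yT : ℚ) (nonsingular_rat_of_eq V hΔ hT) :
      (V.map (Int.castRingHom ℚ)).toAffine.Point) = 0 := by
  haveI := isElliptic_rat V hΔ
  rw [two_nsmul, ← sub_neg_eq_add, sub_eq_zero, Affine.Point.neg_some]
  congr 1
  simp only [Affine.negY, WeierstrassCurve.map, eq_intCast]
  have : (2 : ℚ) * yT + V.a₁ * xT + V.a₃ = 0 := by exact_mod_cast hT2
  linarith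

open scoped Classical in
/-- **`E(ℚ)[2] ⊆ {O, T}`** from the rational `2`-torsion point `T = (x_T, y_T)` and a good odd prime `ℓ₁`
at which `T̃` is the only affine `2`-torsion point (`twoTorsionOnlyB`), by injectivity of reduction on
prime-to-`ℓ₁` torsion. [cite: SilvermanAEC2009, Prop. VII.3.1(b)] -/
theorem twoTorsion_eq_zero_or_eq {xT yT : ℤ}
    (hT : yT ^ 2 + V.a₁ * xT * yT + V.a₃ * yT = xT ^ 3 + V.a₂ * xT ^ 2 + V.a₄ * xT + V.a₆)
    (hT2 : 2 * yT + V.a₁ * xT + V.a₃ = 0)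
    (ℓ₁ : ℕ) [Fact ℓ₁.Prime] (hℓ₁ : ¬ (ℓ₁ : ℤ) ∣ V.Δ) (hodd : ℓ₁ ≠ 2)
    (hB₁ : twoTorsionOnlyB V ℓ₁ xT yT = true)
    (τ : (V.map (Int.castRingHom ℚ)).toAffine.Point) (hτ : (2 : ℤ) • τ = 0) :
    τ = 0 ∨ τ = Affine.Point.some (xT : ℚ) (yT : ℚ)
      (nonsingular_rat_of_eq V (Δ_ne_zero_of_not_dvd V hℓ₁) hT) := by
  have hΔ : V.Δ ≠ 0 := Δ_ne_zero_of_not_dvd V hℓ₁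
  haveI := isElliptic_rat V hΔ
  have hn : ¬ ℓ₁ ∣ 2 := fun hd =>
    hodd ((Nat.prime_dvd_prime_iff_eq (Fact.out : ℓ₁.Prime) Nat.prime_two).mp hd)
  have eT : V.toAffine.Equation xT yT := (Affine.equation_iff xT yT).mpr hT
  have hτ2 : 2 • τ = 0 := by rw [← natCast_zsmul]; exact_mod_cast hτ
  have hred : 2 • reduceMod V ℓ₁ hℓ₁ τ = 0 := by rw [← map_nsmul, hτ2, map_zero]
  rcases eq_zero_or_eq_of_twoTorsionOnlyB V ℓ₁ hB₁ _ hred with h0 | ⟨hns, hsome⟩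
  · exact Or.inl (eq_zero_of_reduceMod_eq_zero V ℓ₁ hℓ₁ τ hn hτ2 h0)
  · right
    set T : (V.map (Int.castRingHom ℚ)).toAffine.Point :=
      .some (xT : ℚ) (yT : ℚ) (nonsingular_rat_of_eq V hΔ hT) with hTdef
    have hTred : reduceMod V ℓ₁ hℓ₁ T = Affine.Point.some (xT : ZMod ℓ₁) (yT : ZMod ℓ₁) hns := by
      rw [hTdef, reduceMod_some V ℓ₁ hℓ₁ eT]
    have h2T : 2 • T = 0 := two_nsmul_some_eq_zero V hΔ hT hT2
    have hdiff0 : reduceMod V ℓ₁ hℓ₁ (τ - T) = 0 := by rw [map_sub, hsome, hTred, sub_self]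
    have hdiff2 : 2 • (τ - T) = 0 := by rw [nsmul_sub, hτ2, h2T, sub_zero]
    exact sub_eq_zero.mp (eq_zero_of_reduceMod_eq_zero V ℓ₁ hℓ₁ (τ - T) hn hdiff2 hdiff0)

/-- COSET TEST MODULO THE RATIONAL `2`-TORSION (Boolean for `decide`): `(α', β') = (α, β) + T̃` by a
chord certificate, and neither `α` nor `α'` is the abscissa of a double in `Ẽ(𝔽_q)`.
[cite: CremonaAlgorithms1997, §3.5] -/
def tCosetFree (V : WeierstrassCurve ℤ) (q : ℕ) [NeZero q] (xT yT α β α' β' : ZMod q) : Bool :=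
  zmodChord V q α β xT yT α' β' && (xDoubleFree V q α && xDoubleFree V q α')

open scoped Classical in
/-- Soundness of `tCosetFree`: with `E(ℚ)[2] ⊆ {O, T}`, a rational point `R` whose reduction `(α, β)`
passes `tCosetFree` at a good prime `q` is not in `2E(ℚ) + E(ℚ)[2]`.
[cite: SilvermanAEC2009, Prop. VII.3.1(b)] -/
theorem not_mem_twoCoset_one_of_tCosetFree (q : ℕ) [Fact q.Prime] (hq : ¬ (q : ℤ) ∣ V.Δ)
    {T R : (V.map (Int.castRingHom ℚ)).toAffine.Point}
    (h2 : ∀ τ : (V.map (Int.castRingHom ℚ)).toAffine.Point, (2 : ℤ) • τ = 0 → τ = 0 ∨ τ = T)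
    {xT yT α β α' β' : ZMod q}
    {hnsT : (V.map (Int.castRingHom (ZMod q))).toAffine.Nonsingular xT yT}
    {hns : (V.map (Int.castRingHom (ZMod q))).toAffine.Nonsingular α β}
    (hTred : reduceMod V q hq T = .some xT yT hnsT) (hR : reduceMod V q hq R = .some α β hns)
    (hfree : tCosetFree V q xT yT α β α' β' = true) :
    R ∉ twoCoset (V.map (Int.castRingHom ℚ)).toAffine.Point 1 := by
  simp only [tCosetFree, Bool.and_eq_true] at hfree
  obtain ⟨hc, hα, hα'⟩ := hfree
  apply not_mem_twoCoset_one_of_twoTorsion_subset h2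
  · apply not_mem_twoCoset_of_map_not_mem (reduceMod V q hq)
    rw [hR]
    exact not_mem_twoCoset_of_xDoubleFree V q hα hns
  · apply not_mem_twoCoset_of_map_not_mem (reduceMod V q hq)
    obtain ⟨h₃, e⟩ := exists_some_add_some_of_zmodChord V q hns hnsT hc
    rw [map_add, hR, hTred, e]
    exact not_mem_twoCoset_of_xDoubleFree V q hα' h₃

end Rational

/-! ### The certificate variant -/

section Assembly

variable (V : WeierstrassCurve ℤ)

/-- **Rank-3 kernel certificate with coset tests modulo the rational `2`-torsion**: integral points
`Pᵢ = (Xᵢ, Yᵢ)`; torsion annihilator `t = 2^e·m` from two kernel point counts; the rational `2`-torsion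
point `T = (x_T, y_T)` with a good odd prime `ℓ₁` where `T̃` is the only `2`-torsion point
(`E(ℚ)[2] = {O, T}`) and a good prime `ℓ₂` where `T̃` is no double (no rational `4`-torsion, so `2m`
kills `E(ℚ)_tors`); and for each of the seven combinations `R` a good prime `q` with `tCosetFree`
(`R̃, R̃ + T̃ ∉ 2Ẽ(𝔽_q)`), the needed sums supplied by chord certificates. Then `3 ≤ rank_ℤ E(ℚ)`.
[cite: CremonaAlgorithms1997, §3.5] [cite: SilvermanAEC2009, Thm. VIII.6.7] -/
theorem three_le_mordellWeilRank_of_kernelCertT3 {X₁ Y₁ X₂ Y₂ X₃ Y₃ : ℤ}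
    (h₁ : Y₁ ^ 2 + V.a₁ * X₁ * Y₁ + V.a₃ * Y₁ = X₁ ^ 3 + V.a₂ * X₁ ^ 2 + V.a₄ * X₁ + V.a₆)
    (h₂ : Y₂ ^ 2 + V.a₁ * X₂ * Y₂ + V.a₃ * Y₂ = X₂ ^ 3 + V.a₂ * X₂ ^ 2 + V.a₄ * X₂ + V.a₆)
    (h₃ : Y₃ ^ 2 + V.a₁ * X₃ * Y₃ + V.a₃ * Y₃ = X₃ ^ 3 + V.a₂ * X₃ ^ 2 + V.a₄ * X₃ + V.a₆)
    {S : List (ℕ × ℕ)} {t e m : ℕ} (hm : m % 2 = 1) (hte : t = 2 ^ e * m)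
    (hS : ∀ ℓN ∈ S, ℓN.1.Prime ∧
      ∀ (x : (V.map (Int.castRingHom ℚ)).toAffine.Point) (n : ℕ), ¬ ℓN.1 ∣ n → n • x = 0 →
        ℓN.2 • x = 0)
    (ht : annihilatorCheck S t = true)
    {xT yT : ℤ}
    (hT : yT ^ 2 + V.a₁ * xT * yT + V.a₃ * yT = xT ^ 3 + V.a₂ * xT ^ 2 + V.a₄ * xT + V.a₆)
    (hT2 : 2 * yT + V.a₁ * xT + V.a₃ = 0)
    (ℓ₁ : ℕ) [Fact ℓ₁.Prime] (hℓ₁ : ¬ (ℓ₁ : ℤ) ∣ V.Δ) (hodd : ℓ₁ ≠ 2)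
    (hB₁ : twoTorsionOnlyB V ℓ₁ xT yT = true)
    (ℓ₂ : ℕ) [Fact ℓ₂.Prime] (hℓ₂ : ¬ (ℓ₂ : ℤ) ∣ V.Δ) (hB₂ : xDoubleFree V ℓ₂ (xT : ZMod ℓ₂) = true)
    (q₁ q₂ q₃ q₁₂ q₁₃ q₂₃ q₁₂₃ : ℕ) [Fact q₁.Prime] [Fact q₂.Prime] [Fact q₃.Prime]
    [Fact q₁₂.Prime] [Fact q₁₃.Prime] [Fact q₂₃.Prime] [Fact q₁₂₃.Prime]
    (hq₁ : ¬ (q₁ : ℤ) ∣ V.Δ) (hq₂ : ¬ (q₂ : ℤ) ∣ V.Δ) (hq₃ : ¬ (q₃ : ℤ) ∣ V.Δ)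
    (hq₁₂ : ¬ (q₁₂ : ℤ) ∣ V.Δ) (hq₁₃ : ¬ (q₁₃ : ℤ) ∣ V.Δ) (hq₂₃ : ¬ (q₂₃ : ℤ) ∣ V.Δ)
    (hq₁₂₃ : ¬ (q₁₂₃ : ℤ) ∣ V.Δ)
    {A₁ B₁ : ℤ}
    (hw₁ : tCosetFree V q₁ (xT : ZMod q₁) (yT : ZMod q₁) (X₁ : ZMod q₁) (Y₁ : ZMod q₁)
      (A₁ : ZMod q₁) (B₁ : ZMod q₁) = true)
    {A₂ B₂ : ℤ}
    (hw₂ : tCosetFree V q₂ (xT : ZMod q₂) (yT : ZMod q₂) (X₂ : ZMod q₂) (Y₂ : ZMod q₂)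
      (A₂ : ZMod q₂) (B₂ : ZMod q₂) = true)
    {A₃ B₃ : ℤ}
    (hw₃ : tCosetFree V q₃ (xT : ZMod q₃) (yT : ZMod q₃) (X₃ : ZMod q₃) (Y₃ : ZMod q₃)
      (A₃ : ZMod q₃) (B₃ : ZMod q₃) = true)
    {X₁₂ Y₁₂ A₁₂ B₁₂ : ℤ}
    (hc₁₂ : zmodChord V q₁₂ (X₁ : ZMod q₁₂) (Y₁ : ZMod q₁₂) (X₂ : ZMod q₁₂) (Y₂ : ZMod q₁₂)
      (X₁₂ : ZMod q₁₂) (Y₁₂ : ZMod q₁₂) = true)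
    (hw₁₂ : tCosetFree V q₁₂ (xT : ZMod q₁₂) (yT : ZMod q₁₂) (X₁₂ : ZMod q₁₂) (Y₁₂ : ZMod q₁₂)
      (A₁₂ : ZMod q₁₂) (B₁₂ : ZMod q₁₂) = true)
    {X₁₃ Y₁₃ A₁₃ B₁₃ : ℤ}
    (hc₁₃ : zmodChord V q₁₃ (X₁ : ZMod q₁₃) (Y₁ : ZMod q₁₃) (X₃ : ZMod q₁₃) (Y₃ : ZMod q₁₃)
      (X₁₃ : ZMod q₁₃) (Y₁₃ : ZMod q₁₃) = true)
    (hw₁₃ : tCosetFree V q₁₃ (xT : ZMod q₁₃) (yT : ZMod q₁₃) (X₁₃ : ZMod q₁₃) (Y₁₃ : ZMod q₁₃)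
      (A₁₃ : ZMod q₁₃) (B₁₃ : ZMod q₁₃) = true)
    {X₂₃ Y₂₃ A₂₃ B₂₃ : ℤ}
    (hc₂₃ : zmodChord V q₂₃ (X₂ : ZMod q₂₃) (Y₂ : ZMod q₂₃) (X₃ : ZMod q₂₃) (Y₃ : ZMod q₂₃)
      (X₂₃ : ZMod q₂₃) (Y₂₃ : ZMod q₂₃) = true)
    (hw₂₃ : tCosetFree V q₂₃ (xT : ZMod q₂₃) (yT : ZMod q₂₃) (X₂₃ : ZMod q₂₃) (Y₂₃ : ZMod q₂₃)
      (A₂₃ : ZMod q₂₃) (B₂₃ : ZMod q₂₃) = true)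
    {X₀ Y₀ X₁₂₃ Y₁₂₃ A₁₂₃ B₁₂₃ : ℤ}
    (hc₀ : zmodChord V q₁₂₃ (X₁ : ZMod q₁₂₃) (Y₁ : ZMod q₁₂₃) (X₂ : ZMod q₁₂₃) (Y₂ : ZMod q₁₂₃)
      (X₀ : ZMod q₁₂₃) (Y₀ : ZMod q₁₂₃) = true)
    (hc₁₂₃ : zmodChord V q₁₂₃ (X₀ : ZMod q₁₂₃) (Y₀ : ZMod q₁₂₃) (X₃ : ZMod q₁₂₃) (Y₃ : ZMod q₁₂₃)
      (X₁₂₃ : ZMod q₁₂₃) (Y₁₂₃ : ZMod q₁₂₃) = true)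
    (hw₁₂₃ : tCosetFree V q₁₂₃ (xT : ZMod q₁₂₃) (yT : ZMod q₁₂₃) (X₁₂₃ : ZMod q₁₂₃)
      (Y₁₂₃ : ZMod q₁₂₃) (A₁₂₃ : ZMod q₁₂₃) (B₁₂₃ : ZMod q₁₂₃) = true) :
    3 ≤ (V.map (Int.castRingHom ℚ)).mordellWeilRank := by
  classical
  have hΔ : V.Δ ≠ 0 := Δ_ne_zero_of_not_dvd V hq₁
  haveI := isElliptic_rat V hΔ
  have hm' : Odd (m : ℤ) := by exact_mod_cast Nat.odd_iff.mpr hm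
  have htors : ∀ x : (V.map (Int.castRingHom ℚ)).toAffine.Point, IsOfFinAddOrder x →
      ((2 : ℤ) ^ 1 * (m : ℤ)) • x = 0 :=
    fun x hx => torsion_zsmul_eq_zero_of_twoTorsionWitness V hte hS ht hT hT2 ℓ₁ hℓ₁ hodd hB₁ ℓ₂ hℓ₂
      hB₂ x hx
  have h2 := twoTorsion_eq_zero_or_eq V hT hT2 ℓ₁ hℓ₁ hodd hB₁
  have eT : V.toAffine.Equation xT yT := (Affine.equation_iff xT yT).mpr hT
  have e₁ : V.toAffine.Equation X₁ Y₁ := (Affine.equation_iff X₁ Y₁).mpr h₁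
  have e₂ : V.toAffine.Equation X₂ Y₂ := (Affine.equation_iff X₂ Y₂).mpr h₂
  have e₃ : V.toAffine.Equation X₃ Y₃ := (Affine.equation_iff X₃ Y₃).mpr h₃
  refine three_le_mordellWeilRank_of_cosetWitness (V.map (Int.castRingHom ℚ)) hm' htors
    (P₁ := .some _ _ (nonsingular_rat_of_eq V hΔ h₁))
    (P₂ := .some _ _ (nonsingular_rat_of_eq V hΔ h₂))
    (P₃ := .some _ _ (nonsingular_rat_of_eq V hΔ h₃)) ?_ ?_ ?_ ?_ ?_ ?_ ?_
  · exact not_mem_twoCoset_one_of_tCosetFree V q₁ hq₁ h2 (reduceMod_some V q₁ hq₁ eT _)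
      (reduceMod_some V q₁ hq₁ e₁ _) hw₁
  · exact not_mem_twoCoset_one_of_tCosetFree V q₂ hq₂ h2 (reduceMod_some V q₂ hq₂ eT _)
      (reduceMod_some V q₂ hq₂ e₂ _) hw₂
  · exact not_mem_twoCoset_one_of_tCosetFree V q₃ hq₃ h2 (reduceMod_some V q₃ hq₃ eT _)
      (reduceMod_some V q₃ hq₃ e₃ _) hw₃
  · obtain ⟨h', e⟩ := exists_some_add_some_of_zmodChord V q₁₂
      (nonsingular_zmod_of_equation V q₁₂ hq₁₂ e₁) (nonsingular_zmod_of_equation V q₁₂ hq₁₂ e₂) hc₁₂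
    refine not_mem_twoCoset_one_of_tCosetFree V q₁₂ hq₁₂ h2 (hns := h') (reduceMod_some V q₁₂ hq₁₂ eT _) ?_ hw₁₂
    rw [map_add, reduceMod_some V q₁₂ hq₁₂ e₁, reduceMod_some V q₁₂ hq₁₂ e₂, e]
  · obtain ⟨h', e⟩ := exists_some_add_some_of_zmodChord V q₁₃
      (nonsingular_zmod_of_equation V q₁₃ hq₁₃ e₁) (nonsingular_zmod_of_equation V q₁₃ hq₁₃ e₃) hc₁₃
    refine not_mem_twoCoset_one_of_tCosetFree V q₁₃ hq₁₃ h2 (hns := h') (reduceMod_some V q₁₃ hq₁₃ eT _) ?_ hw₁₃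
    rw [map_add, reduceMod_some V q₁₃ hq₁₃ e₁, reduceMod_some V q₁₃ hq₁₃ e₃, e]
  · obtain ⟨h', e⟩ := exists_some_add_some_of_zmodChord V q₂₃
      (nonsingular_zmod_of_equation V q₂₃ hq₂₃ e₂) (nonsingular_zmod_of_equation V q₂₃ hq₂₃ e₃) hc₂₃
    refine not_mem_twoCoset_one_of_tCosetFree V q₂₃ hq₂₃ h2 (hns := h') (reduceMod_some V q₂₃ hq₂₃ eT _) ?_ hw₂₃
    rw [map_add, reduceMod_some V q₂₃ hq₂₃ e₂, reduceMod_some V q₂₃ hq₂₃ e₃, e]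
  · obtain ⟨h', e⟩ := exists_some_add_some_of_zmodChord V q₁₂₃
      (nonsingular_zmod_of_equation V q₁₂₃ hq₁₂₃ e₁) (nonsingular_zmod_of_equation V q₁₂₃ hq₁₂₃ e₂)
      hc₀
    obtain ⟨h'', e'⟩ := exists_some_add_some_of_zmodChord V q₁₂₃ h'
      (nonsingular_zmod_of_equation V q₁₂₃ hq₁₂₃ e₃) hc₁₂₃
    refine not_mem_twoCoset_one_of_tCosetFree V q₁₂₃ hq₁₂₃ h2 (hns := h'') (reduceMod_some V q₁₂₃ hq₁₂₃ eT _) ?_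
      hw₁₂₃
    rw [map_add, map_add, reduceMod_some V q₁₂₃ hq₁₂₃ e₁, reduceMod_some V q₁₂₃ hq₁₂₃ e₂,
      reduceMod_some V q₁₂₃ hq₁₂₃ e₃, e, e']

end Assembly

end Summit.BirchSwinnertonDyer.BirchSwinnertonDyer.Rank2Observatory
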